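import Summits.HodgeConjecture.HodgeConjecture.Theses.VHCAbelianSchemesRoad
import Summits.HodgeConjecture.HodgeConjecture.Theorems.VHCAbelianSchemesRoadLocallyServedAnchor
import Summits.HodgeConjecture.HodgeConjecture.Theorems.VHCAbelianSchemesRoadSecantQuotientAnchorPinnedDefs
import Summits.HodgeConjecture.HodgeConjecture.Theorems.VHCAbelianSchemesRoadTwistedDoorPrimeIsoRespects
import Summits.HodgeConjecture.HodgeConjecture.Theorems.VHCAbelianSchemesRoadLocallyServedAnchorCarriedPair
import Summits.HodgeConjecture.HodgeConjecture.Theorems.VHCAbelianSchemesRoadSecantQuotientOffHyperellipticOfPrintForall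
import Literature.AlgebraicGeometry.HodgeTheory.SecantQuotientJacobianTwistedCarrierForall
import Summits.HodgeConjecture.HodgeConjecture.Theorems.VHCAbelianSchemesRoadSecondCarriedHGoodTypingDefs
import Summits.HodgeConjecture.HodgeConjecture.Theorems.VHCAbelianSchemesRoadSecantQuotientHasMover
import Summits.HodgeConjecture.HodgeConjecture.Theorems.VHCAbelianSchemesRoadSecondCarriedOfNodes
import Summits.HodgeConjecture.HodgeConjecture.Theorems.VHCAbelianSchemesRoadSecondCarriedOfTGRR
import Summits.HodgeConjecture.HodgeConjecture.Theorems.VHCAbelianSchemesRoadIsogenyPushforwardChernCharacterHolds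
import Summits.HodgeConjecture.HodgeConjecture.Theorems.VHCAbelianSchemesRoadPrintSheafHandleDefs
import Summits.HodgeConjecture.HodgeConjecture.Theorems.VHCAbelianSchemesRoadOffDiagonalSomeMoverOfPrintSheafHandle
import Summits.HodgeConjecture.HodgeConjecture.Theorems.VHCAbelianSchemesRoadSecantQuotientPinnedRigidityOfEndInt
import Literature.AlgebraicGeometry.Motives.AbelianVarietyManinMumfordRaynaud
import Summits.HodgeConjecture.HodgeConjecture.Theorems.VHCAbelianSchemesRoadMoverTrapDefs
import Summits.HodgeConjecture.HodgeConjecture.Theorems.VHCAbelianSchemesRoadMoverConfinementOfKSimpleHolds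
import Summits.HodgeConjecture.HodgeConjecture.Theorems.VHCAbelianSchemesRoadKSimpleOfEndTrivial
import Summits.HodgeConjecture.HodgeConjecture.Theorems.VHCAbelianSchemesRoadNowhereDisplaceableDefs
import Summits.HodgeConjecture.HodgeConjecture.Theorems.VHCAbelianSchemesRoadProperJumpOfConfinedLifts
import Summits.HodgeConjecture.HodgeConjecture.Theorems.VHCAbelianSchemesRoadNowhereDisplaceableOfLine
import Summits.HodgeConjecture.HodgeConjecture.Theorems.VHCAbelianSchemesRoadExtJumpLocusLiftsOfRetract
import Summits.HodgeConjecture.HodgeConjecture.Theorems.VHCAbelianSchemesRoadPreimageProperClosedOfIsogeny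
import HarnessLib

/-!
# Road №4 (`VHCAbelianSchemesRoad`) — crux `DiagLocalOfMarkmanPinnedForall` (stmt-HodgeConjecture-26512): THE LIFTED CARRIER (N-U⁺)
# = the «transfer» lens's DESCENT-FORM RESIDUE of the negation line's node (S4) ∕ (c4a-E) — hypothesis form, SORRY-FREE

Seat `plan-lens-HodgeAV-26512-transfer` gen 4 (planner; lens «transfer» = Buchweitz–Flenner functoriality of `At`/`Tr` under the finite étale
push-forward `q : P = J × Ĵ → Y = P/K`, first non-transferring piece). Companion of `FactorJumpIsogeny.lean` (g3, (U-fac) ∕ (U-pre)) and of the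
negation line's workfile `Lines/NowhereDisplaceable.lean` v2 (969c0abb8a7a; stubs (N-F) `stub_extJumpLocus_lifts`, (N-I) `stub_properJump_of_confinedLifts`
= LANDED p673373, (N-U) `stub_upstairsProperJumpCarrierExists_End`, (N-E)). Nothing here is registered; nothing is a stub; every theorem is sorry-free
over ACCEPTED tree modules (p664145, p665569, p667380, p672648, p673373, p674094, p674291, p674495). HC ∕ HC_AV ∕ №4 are NOT proved here.

## The transfer reading (why this residue, in one paragraph)

In the re-cut `(N-F) → (N-I) → (N-U) → (S4)` the composition `properJumpCarrierExists_End_of_line` (p674094) consumes (N-F) «jumps lift along `q` for EVERY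
bounded vector-bundle complex `E•` on `Y`» ONLY at the witness complex `𝓓.E` produced by (N-U). For an ARBITRARY `E•` the lift is the trace ∕ Maschke
retract `E• → q_*q^*E• → E•` ((R), core-w5's `PullbackPushforwardRetract` programme, p674291 gives `(R) → (N-F)`), i.e. exactly the part of
Buchweitz–Flenner's functoriality that does NOT transfer for free (a left inverse of the unit `η_E`, natural in `E`). But for the complexes the line
actually builds — print's DESCENDED carriers `Ē_a` on `Y`, whose pull-back `q^*Ē_a ≅ E ⊗ det^{-a}` carries a `K`-linearisation — the lift clause is the
equivariant-descent identity `Hom_{D(Y)}(t_{q p}^*Ē, Ē[k]) = Hom_{D(P)}(t_p^*q^*Ē, q^*Ē[k])^K ⊆ Hom_{D(P)}(…)`, which needs no trace splitting of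
arbitrary complexes (char 0, `|K| = d²` invertible; [Mumford 1970, §7 Thm. 4 (p. 72) and §12 Thm. 1 (p. 111)], [Mukai 1978, §3]). So the lift clause's
natural home is the DESCENDED OBJECT, not `q^*` in general: we move it from the universally quantified (N-F) into the existential witness of (N-U).

## Contents

§1 the statements as `Prop`s: (N-U) `UpstairsProperJumpCarrierEnd`, (N-F) `ExtJumpLocusLifts`, the pointwise lift clause `JumpsLiftAt D E`,
**(N-U⁺) `UpstairsProperJumpLiftedCarrierEnd` := (N-U)'s binders VERBATIM, conclusion `ProperJump (J × Ĵ) (q^*𝓓.E) ∧ JumpsLiftAt D 𝓓.E`**, (S4)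
`ProperJumpCarrierEnd` (birth v3.18 l.479–486 VERBATIM), (R) `PushPullRetract` (p674291's binder VERBATIM), its pointwise instance (R)_E `RetractAt D E`
(= the REYNOLDS PROJECTOR for a descended carrier), the retract form (N-U_R) `UpstairsProperJumpRetractCarrierEnd` := (N-U) ∧ `RetractAt D 𝓓.E`, and the
factor form (N-U⁺ᶠ) `FactorConfinedLiftedCarrierEnd` (g3's (U-fac) + the lift clause).
§2 logic, sorry-free: `upstairs_of_lifted : (N-U⁺) → (N-U)`; `lifted_of_upstairs_of_lifts : (N-F) → (N-U) → (N-U⁺)`;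
`lifted_of_upstairs_of_retract : (R) → (N-U) → (N-U⁺)` (p674291 BY NAME); **`jumpsLiftAt_of_retractAt : IsBoundedVBComplex E → (R)_E → JumpsLiftAt D E`**
(p674291's proof LOCALISED — it consumes the retract only at `E•`), hence `lifted_of_retractCarrier : (N-U_R) → (N-U⁺)`; **`properJumpCarrierEnd_of_lifted : (N-U⁺) → (S4)`** over the LANDED (N-I)
`NowhereDisplaceable.properJump_of_confinedLifts` (p673373) and `confinedLifts_of_lifts_of_upstairs` (p674094) — NO (N-F), NO (R);
`lifted_of_factorConfinedLifted : (N-U⁺ᶠ) → (N-U⁺)` over the LANDED (U-pre) `preimage_properClosed_of_isIsogeny` (p674495);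
`printSheafHandleExistsEnd_of_lifted : Raynaud1983_maninMumford → (N-U⁺) → ∀ C, PrintSheafHandleExistsEnd C` through p664145's
`printSheafHandleExistsEnd_of_stubs` with the LANDED S2 (p667380) and S3 (p665569) BY NAME.
§3 the crux BY NAME in hypothesis form: `DiagLocalOfMarkmanPinnedForall_of_printSheafHandleExistsEnd : (∀ C, PrintSheafHandleExistsEnd C) → ⟨1′⟩ →
IsogenyPushforwardAdmissibilityTransferPrime → ⟨2r″⟩ → ⟨3′ᴸ⟩ → <the route decl>` (`Lines/NowhereDisplaceable.lean` v2 §4 transcribed with (c4a-E) DISPLAYED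
instead of taken from stubs — reusable by every line that closes (c4a-E)), and `DiagLocalOfMarkmanPinnedForall_of_lifted : Raynaud1983 → (N-U⁺) → ⟨1′⟩ → (c1) →
⟨2r″⟩ → ⟨3′ᴸ⟩ → <the route decl>`.

## Ordering (N2-8 style) and what is NOT claimed

`(N-U⁺) ⇒ (N-U)` (projection) and `(N-U⁺) ⇒ (S4)` (this file, zero open input); `(N-U) ∧ (N-F) ⇒ (N-U⁺)`, `(N-U) ∧ (R) ⇒ (N-U⁺)`; `(S4) ⇏ (N-U⁺)` and
`(S4) ⇏ (N-U)` are EXPECTED non-implications (the upstairs jump locus `J_P(q^*E•) ⊇ q⁻¹ J_Y(E•)` may be strictly larger: twisted jumps `t_p^*q^*E ≅ q^*E ⊗ L`),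
not theorems. Width toward 26512 is unchanged (O₁ = (N-U)'s research content, PENCIL-26512-T12 ∕ T13 ∕ N22); the gain is on the trigger side only:
(S4) ⟸ (N-U⁺) with the library debt (R) removed from the critical path, (R) re-entering only as the OPTIONAL upgrade `lifted_of_upstairs_of_retract`.
-/

open CategoryTheory CategoryTheory.Category CategoryTheory.Limits AlgebraicGeometry Topology
open DerivedCategory

namespace Summit.HodgeConjecture.HodgeConjecture.Cruxes.DiagLocalOfMarkmanPinnedForall.LiftedCarrier

set_option linter.dupNamespace false -- the Cruxes namespace repeats the summit name, as in every file of this directory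

open Literature.AlgebraicGeometry Literature.AlgebraicGeometry.Motives Literature.AlgebraicGeometry.Motives.AbelianVariety
open Literature.AlgebraicGeometry.HodgeTheory Literature.AlgebraicGeometry.Markman2025
open Literature.AlgebraicGeometry.KTheory Literature.AlgebraicGeometry.Modules
open Literature.AlgebraicTopology.SingularHomology
open Summit.HodgeConjecture.HodgeConjecture.Ring2.SemiregularRepresentatives
open Summit.HodgeConjecture.HodgeConjecture.Ring2.SemiregularRepresentatives.MoverTrap
open Summit.HodgeConjecture.HodgeConjecture.Ring2.SemiregularRepresentatives.NowhereDisplaceable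
open Summit.HodgeConjecture.HodgeConjecture.Ring2.AbelianAll (carriedClasses)
open Literature.Barriers.HodgeConjecture (divisorClassesSpan)

/-! ## §1 The statements -/

/-- **(N-U) as a `Prop`** — the negation line's registered stub `stub_upstairsProperJumpCarrierExists_End` VERBATIM (workfile v2 l.270): at every End-trivial,
OFF-hyperelliptic, orbit-disjoint datum some pinned-served class carries a pinned twisted datum whose PULLED-BACK complex `q^* 𝓓.E` on `P = J × Ĵ` has its
Ext-jump locus inside `{1} ∪ V(ℂ)` for a proper closed `V ⊊ J × Ĵ`. [cite: Markman2025SecantWeil, §9.3 Lemma 9.3.11] [cite: Mukai1978, §3] -/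
@[conjecture] def UpstairsProperJumpCarrierEnd : Prop :=
  ∀ (C : ChernCharacterBetti) (D : SecantQuotientDatum) (θ₀ : complexBetti D.𝒥.J.X 2),
    ¬ D.𝒥.IsHyperelliptic → OrbitTranslatesDisjoint D.𝒥 D.G₁ D.G₂ → D.𝒥.J.IsPolarizationClassOf D.Θ θ₀ → EndTrivial D →
    ∃ γ ∈ secantQuotientServedClassesPinned D.Y.X (D.hY θ₀), ∃ 𝓓 : PinnedTwistedDatum C AdmTw' D.Y.X (D.hY θ₀) γ,
      ProperJump D.P (quotientPullbackComplex D 𝓓.E)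

/-- **(N-F) as a `Prop`** — the negation line's registered stub `stub_extJumpLocus_lifts` VERBATIM (workfile v2 l.239): for EVERY bounded vector-bundle complex
`E•` on `Y`, a jump of `E•` at `q(p)` is a jump of `q^*E•` at `p`. [cite: Mukai1978, §3] [cite: StacksProject, Tag 0BVH and Tag 0DVC] -/
@[conjecture] def ExtJumpLocusLifts : Prop :=
  ∀ (D : SecantQuotientDatum) (E : CochainComplex D.Y.X.left.Modules ℤ), IsBoundedVBComplex E →
    ∀ p : D.P.Points ℂ, AlgPoints.map D.q.hom.hom.hom p ∈ extJumpLocus D.Y E → p ∈ extJumpLocus D.P (quotientPullbackComplex D E)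

/-- **The lift clause AT ONE COMPLEX** `E•` on `Y = D.Y.X`: jumps of `E•` lift along `q` to jumps of `q^*E•` (the pointwise instance of (N-F) the composition
`properJumpCarrierExists_End_of_line` actually consumes, namely at `E• := 𝓓.E`). [cite: Mukai1978, §3] [cite: MumfordAV1970, §7 Thm. 4 (p. 72)] -/
def JumpsLiftAt (D : SecantQuotientDatum) (E : CochainComplex D.Y.X.left.Modules ℤ) : Prop :=
  ∀ p : D.P.Points ℂ, AlgPoints.map D.q.hom.hom.hom p ∈ extJumpLocus D.Y E → p ∈ extJumpLocus D.P (quotientPullbackComplex D E)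

/-- **(N-U⁺) THE LIFTED CARRIER** — (N-U)'s binders VERBATIM; conclusion `ProperJump (J × Ĵ) (q^* 𝓓.E) ∧ JumpsLiftAt D 𝓓.E`: the witness datum's pulled-back
complex has proper upstairs jump locus AND its downstairs jumps lift. For a DESCENDED carrier (print's `Ē_a`, `q^*Ē_a ≅ E ⊗ det^{-a}` with its
`K`-linearisation) the second conjunct is the equivariant-descent identity `Hom_{D(Y)} = (Hom_{D(P)})^K` (char 0), not the trace retract of an arbitrary complex.
[cite: Markman2025SecantWeil, §9.3 Lemma 9.3.11] [cite: MumfordAV1970, §7 Thm. 4 (p. 72) and §12 Thm. 1 (p. 111)] [cite: Mukai1978, §3] -/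
@[conjecture] def UpstairsProperJumpLiftedCarrierEnd : Prop :=
  ∀ (C : ChernCharacterBetti) (D : SecantQuotientDatum) (θ₀ : complexBetti D.𝒥.J.X 2),
    ¬ D.𝒥.IsHyperelliptic → OrbitTranslatesDisjoint D.𝒥 D.G₁ D.G₂ → D.𝒥.J.IsPolarizationClassOf D.Θ θ₀ → EndTrivial D →
    ∃ γ ∈ secantQuotientServedClassesPinned D.Y.X (D.hY θ₀), ∃ 𝓓 : PinnedTwistedDatum C AdmTw' D.Y.X (D.hY θ₀) γ,
      ProperJump D.P (quotientPullbackComplex D 𝓓.E) ∧ JumpsLiftAt D 𝓓.E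

/-- **(S4) as a `Prop`** — birth v3.18 l.479–486 ∕ the conclusion of p674094's `properJumpCarrierExists_End_of_line` VERBATIM (the T3 designate
`stub_properJumpCarrierExists_End`): a pinned-served class carries a pinned twisted datum whose complex on `Y` has PROPER Ext-jump locus.
[cite: Markman2025SecantWeil, §9.3 Lemma 9.3.11] -/
@[conjecture] def ProperJumpCarrierEnd : Prop :=
  ∀ (C : ChernCharacterBetti) (D : SecantQuotientDatum) (θ₀ : complexBetti D.𝒥.J.X 2),
    ¬ D.𝒥.IsHyperelliptic → OrbitTranslatesDisjoint D.𝒥 D.G₁ D.G₂ → D.𝒥.J.IsPolarizationClassOf D.Θ θ₀ → EndTrivial D →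
    ∃ γ ∈ secantQuotientServedClassesPinned D.Y.X (D.hY θ₀), ∃ 𝓓 : PinnedTwistedDatum C AdmTw' D.Y.X (D.hY θ₀) γ,
      ∃ (V : SchemeOver ℂ) (ι : V ⟶ D.Y.X), IsClosedImmersion ι.left ∧
        Set.range (AlgPoints.map (L := ℂ) ι) ≠ Set.univ ∧
        extJumpLocus D.Y 𝓓.E ⊆ {1} ∪ Set.range (AlgPoints.map (L := ℂ) ι)

/-- **(R) as a `Prop`** — the binder of p674291's `extJumpLocus_lifts_of_retract` VERBATIM: every bounded vector-bundle complex `E•` on `Y` is a retract of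
`q_*q^*E•` (the trace ∕ Maschke splitting of the unit; core-w5's `PullbackPushforwardRetract` programme). [cite: Mukai1978, §3] [cite: Lipman2009, Prop. 3.2.3] -/
@[conjecture] def PushPullRetract : Prop :=
  ∀ (D : SecantQuotientDatum) (E : CochainComplex D.Y.X.left.Modules ℤ), IsBoundedVBComplex E →
    ∃ (i : E ⟶ ((Scheme.Modules.pushforward (Hom.toSchemeHom D.q)).mapHomologicalComplex (ComplexShape.up ℤ)).obj (quotientPullbackComplex D E))
      (r : ((Scheme.Modules.pushforward (Hom.toSchemeHom D.q)).mapHomologicalComplex (ComplexShape.up ℤ)).obj (quotientPullbackComplex D E) ⟶ E),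
      i ≫ r = 𝟙 E

/-- **(R)_E — RETRACT AT ONE COMPLEX**: `E•` is a retract of `q_*q^*E•` (the pointwise instance of (R)). For a DESCENDED carrier `Ē = (q_*F)^K` (print's
`Ē_a`, `F = E ⊗ det^{-a}` with its `K`-linearisation, `q^*Ē ≅ F`) this is the REYNOLDS PROJECTOR `(1/|K|) Σ_{g ∈ K} g` on `q_*F` (an `𝒪_Y`-linear idempotent,
char 0) — NOT the trace of an arbitrary finite locally free algebra, which is what (R) for every `E•` needs.
[cite: MumfordAV1970, §7 Thm. 4 (p. 72) and §12 Thm. 1 (p. 111)] [cite: Mukai1978, §3] -/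
def RetractAt (D : SecantQuotientDatum) (E : CochainComplex D.Y.X.left.Modules ℤ) : Prop :=
  ∃ (i : E ⟶ ((Scheme.Modules.pushforward (Hom.toSchemeHom D.q)).mapHomologicalComplex (ComplexShape.up ℤ)).obj (quotientPullbackComplex D E))
    (r : ((Scheme.Modules.pushforward (Hom.toSchemeHom D.q)).mapHomologicalComplex (ComplexShape.up ℤ)).obj (quotientPullbackComplex D E) ⟶ E),
    i ≫ r = 𝟙 E

/-- **(N-U_R) THE RETRACT CARRIER** — (N-U)'s binders VERBATIM; conclusion `ProperJump (J × Ĵ) (q^* 𝓓.E) ∧ RetractAt D 𝓓.E`: the form in which a closer of (N-U)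
following print's descent construction delivers the lift clause (Reynolds projector on `q_*(E ⊗ det^{-a})`). [cite: Markman2025SecantWeil, §9.3 Lemma 9.3.11]
[cite: MumfordAV1970, §7 Thm. 4 (p. 72)] -/
@[conjecture] def UpstairsProperJumpRetractCarrierEnd : Prop :=
  ∀ (C : ChernCharacterBetti) (D : SecantQuotientDatum) (θ₀ : complexBetti D.𝒥.J.X 2),
    ¬ D.𝒥.IsHyperelliptic → OrbitTranslatesDisjoint D.𝒥 D.G₁ D.G₂ → D.𝒥.J.IsPolarizationClassOf D.Θ θ₀ → EndTrivial D →
    ∃ γ ∈ secantQuotientServedClassesPinned D.Y.X (D.hY θ₀), ∃ 𝓓 : PinnedTwistedDatum C AdmTw' D.Y.X (D.hY θ₀) γ,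
      ProperJump D.P (quotientPullbackComplex D 𝓓.E) ∧ RetractAt D 𝓓.E

/-- **(N-U⁺ᶠ) THE FACTOR-CONFINED LIFTED CARRIER** — g3's (U-fac) `FactorJumpIsogeny.FactorConfinedCarrierEnd` (an isogeny `Λ` of `J × Ĵ` maps the upstairs
jump locus into a proper closed `W`) with the lift clause added; print's shape is `Λ = Λ₂ = (φ ∘ pr₁, pr₂)`, `W = J₂ ∪ (J × {𝒪})`-type loci.
[cite: Markman2025SecantWeil, §9.3 Lemma 9.3.11] [cite: MumfordAV1970, §7 Thm. 4 (p. 72)] -/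
@[conjecture] def FactorConfinedLiftedCarrierEnd : Prop :=
  ∀ (C : ChernCharacterBetti) (D : SecantQuotientDatum) (θ₀ : complexBetti D.𝒥.J.X 2),
    ¬ D.𝒥.IsHyperelliptic → OrbitTranslatesDisjoint D.𝒥 D.G₁ D.G₂ → D.𝒥.J.IsPolarizationClassOf D.Θ θ₀ → EndTrivial D →
    ∃ γ ∈ secantQuotientServedClassesPinned D.Y.X (D.hY θ₀), ∃ 𝓓 : PinnedTwistedDatum C AdmTw' D.Y.X (D.hY θ₀) γ,
      (∃ (Λ : D.P ⟶ D.P), IsIsogeny Λ ∧ ∃ (W : SchemeOver ℂ) (κ : W ⟶ D.P.X), IsClosedImmersion κ.left ∧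
        Set.range (AlgPoints.map (L := ℂ) κ) ≠ Set.univ ∧
        ∀ p ∈ extJumpLocus D.P (quotientPullbackComplex D 𝓓.E), AlgPoints.map Λ.hom.hom.hom p ∈ Set.range (AlgPoints.map (L := ℂ) κ)) ∧
      JumpsLiftAt D 𝓓.E

/-! ## §2 Logic (sorry-free, over landed bricks only) -/

/-- `(N-U⁺) → (N-U)`: forget the lift clause. -/
theorem upstairs_of_lifted (h : UpstairsProperJumpLiftedCarrierEnd) : UpstairsProperJumpCarrierEnd := by
  intro C D θ₀ hnh hH hθ₀ hEnd
  obtain ⟨γ, hγ, 𝓓, hP, -⟩ := h C D θ₀ hnh hH hθ₀ hEnd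
  exact ⟨γ, hγ, 𝓓, hP⟩

/-- `(N-F) → (N-U) → (N-U⁺)`: the universally quantified lift gives the lift clause at the witness. -/
theorem lifted_of_upstairs_of_lifts (hF : ExtJumpLocusLifts) (hU : UpstairsProperJumpCarrierEnd) : UpstairsProperJumpLiftedCarrierEnd := by
  intro C D θ₀ hnh hH hθ₀ hEnd
  obtain ⟨γ, hγ, 𝓓, hP⟩ := hU C D θ₀ hnh hH hθ₀ hEnd
  exact ⟨γ, hγ, 𝓓, hP, hF D 𝓓.E 𝓓.bounded⟩

/-- `(R) → (N-U) → (N-U⁺)` — the OPTIONAL upgrade path: p674291's `extJumpLocus_lifts_of_retract : (R) → (N-F)` BY NAME. [cite: Mukai1978, §3] -/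
theorem lifted_of_upstairs_of_retract (hret : PushPullRetract) (hU : UpstairsProperJumpCarrierEnd) : UpstairsProperJumpLiftedCarrierEnd :=
  lifted_of_upstairs_of_lifts (extJumpLocus_lifts_of_retract hret) hU

/-- **(R)_E → LIFT AT `E•`** — p674291's `extJumpLocus_lifts_of_retract` LOCALISED at one complex (its proof transcribed: it consumes the retract only at
`(D, E•)`): a non-zero `φ : τ_{q p}^*E• → E•[k]` stays non-zero after `≫ i` (retract), crosses the derived adjunction along the affine `q` (p674291's
`shiftedHomLinearEquivPullbackPushforwardOfVectorBundles`) and the iso `q^*τ_{q p}^* ≅ τ_p^*q^*`. [cite: Mukai1978, §3] [cite: StacksProject, Tag 0BVH and Tag 0DVC]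
[cite: Lipman2009, Prop. 3.2.3] -/
theorem jumpsLiftAt_of_retractAt (D : SecantQuotientDatum) (E : CochainComplex D.Y.X.left.Modules ℤ) (hE : IsBoundedVBComplex E)
    (hret : RetractAt D E) : JumpsLiftAt D E := by
  intro p hp
  letI := HasDerivedCategory.standard D.Y.X.left.Modules
  letI := HasDerivedCategory.standard D.P.X.left.Modules
  obtain ⟨k, hk⟩ := hp
  refine ⟨k, ?_⟩
  -- a non-zero class downstairs
  rw [not_subsingleton_iff_nontrivial] at hk
  obtain ⟨φ, hφ⟩ := exists_ne (0 : ShiftedHom (Q.obj (translationPullbackComplex D.Y (AlgPoints.map D.q.hom.hom.hom p) E)) (Q.obj E) k)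
  -- push it into `q_*q^*E` along the retract AT `E`
  obtain ⟨i, r, hir⟩ := hret
  set ψ : ShiftedHom (Q.obj (translationPullbackComplex D.Y (AlgPoints.map D.q.hom.hom.hom p) E))
      (Q.obj (((Scheme.Modules.pushforward (Hom.toSchemeHom D.q)).mapHomologicalComplex (ComplexShape.up ℤ)).obj (quotientPullbackComplex D E))) k :=
    φ ≫ (Q.map i)⟦k⟧' with hψdef
  have hψ : ψ ≠ 0 := by
    intro h0
    apply hφ
    have hback : ψ ≫ (Q.map r)⟦k⟧' = φ := by
      rw [hψdef, assoc, ← Functor.map_comp, ← Functor.map_comp, hir, CategoryTheory.Functor.map_id, CategoryTheory.Functor.map_id, comp_id]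
    rw [← hback, h0, zero_comp]
  -- the derived adjunction along the affine `q`
  haveI : IsFinite (Hom.toSchemeHom D.q) := D.isIsogeny_q.2
  haveI : (Scheme.Modules.pushforward (Hom.toSchemeHom D.q)).Linear ℂ := linear_pushforward D.q.hom.hom.hom
  have hM : IsBoundedVBComplex (translationPullbackComplex D.Y (AlgPoints.map D.q.hom.hom.hom p) E) := hE.pullback _
  have hL : IsBoundedVBComplex (quotientPullbackComplex D E) := hE.pullback _
  obtain ⟨a₀, b₀, hMa, hMb⟩ := IsBoundedVBComplex.exists_bounds hM
  obtain ⟨a, _, hLa, _⟩ := IsBoundedVBComplex.exists_bounds hL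
  let Ψ := shiftedHomLinearEquivPullbackPushforwardOfVectorBundles (𝕜 := ℂ) (Hom.toSchemeHom D.q)
    (translationPullbackComplex D.Y (AlgPoints.map D.q.hom.hom.hom p) E) a₀ b₀ hMa hMb hM.isFiniteLocallyFree
    (quotientPullbackComplex D E) a hLa hL.isFiniteLocallyFree k
  have hχ : Ψ.symm ψ ≠ 0 := by
    intro h0
    apply hψ
    have := congrArg Ψ h0
    rwa [LinearEquiv.apply_symm_apply, map_zero] at this
  -- transport along `τ_p^* q^* ≅ q^* τ_{q p}^*`
  obtain ⟨e⟩ := nonempty_quotientPullback_translationPullback_iso D p E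
  intro hsub
  apply hχ
  have hzero : Q.map e.inv ≫ Ψ.symm ψ = 0 := Subsingleton.elim _ _
  calc Ψ.symm ψ = Q.map e.hom ≫ Q.map e.inv ≫ Ψ.symm ψ := by
        rw [← assoc, ← Functor.map_comp, Iso.hom_inv_id, CategoryTheory.Functor.map_id, id_comp]
    _ = 0 := by rw [hzero, comp_zero]

/-- (R) gives (R)_E everywhere (for the record). -/
theorem retractAt_of_pushPullRetract (hret : PushPullRetract) (D : SecantQuotientDatum) (E : CochainComplex D.Y.X.left.Modules ℤ)
    (hE : IsBoundedVBComplex E) : RetractAt D E :=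
  hret D E hE

/-- **`(N-U_R) → (N-U⁺)`**: the retract at the witness gives the lift clause at the witness (`jumpsLiftAt_of_retractAt` with `𝓓.bounded`). -/
theorem lifted_of_retractCarrier (h : UpstairsProperJumpRetractCarrierEnd) : UpstairsProperJumpLiftedCarrierEnd := by
  intro C D θ₀ hnh hH hθ₀ hEnd
  obtain ⟨γ, hγ, 𝓓, hP, hret⟩ := h C D θ₀ hnh hH hθ₀ hEnd
  exact ⟨γ, hγ, 𝓓, hP, jumpsLiftAt_of_retractAt D 𝓓.E 𝓓.bounded hret⟩

/-- **`(N-U⁺) → (S4)` WITH NO FURTHER INPUT** — jump descent for the witness complex: the LANDED (N-I) `properJump_of_confinedLifts` (p673373) fed by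
`confinedLifts_of_lifts_of_upstairs` (p674094) at `E• := 𝓓.E`. [cite: MumfordAV1970, §7 Thm. 4 (p. 72)] [cite: Markman2025SecantWeil, §9.3 Lemma 9.3.11] -/
theorem properJumpCarrierEnd_of_lifted (h : UpstairsProperJumpLiftedCarrierEnd) : ProperJumpCarrierEnd := by
  intro C D θ₀ hnh hH hθ₀ hEnd
  obtain ⟨γ, hγ, 𝓓, ⟨V, ι, hι, hV, hconf⟩, hlift⟩ := h C D θ₀ hnh hH hθ₀ hEnd
  exact ⟨γ, hγ, 𝓓, properJump_of_confinedLifts D 𝓓.E V ι hι hV (confinedLifts_of_lifts_of_upstairs hlift hconf)⟩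

/-- `(N-U⁺ᶠ) → (N-U⁺)`: the preimage of the proper closed `W` under the isogeny `Λ` is proper closed — the LANDED (U-pre) `preimage_properClosed_of_isIsogeny`
(p674495) BY NAME. [cite: MumfordAV1970, §7 Thm. 4 (p. 72)] -/
theorem lifted_of_factorConfinedLifted (h : FactorConfinedLiftedCarrierEnd) : UpstairsProperJumpLiftedCarrierEnd := by
  intro C D θ₀ hnh hH hθ₀ hEnd
  obtain ⟨γ, hγ, 𝓓, ⟨Λ, hΛ, W, κ, hκ, hW, hconf⟩, hlift⟩ := h C D θ₀ hnh hH hθ₀ hEnd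
  obtain ⟨V, ι, hι, hV, hpre⟩ := preimage_properClosed_of_isIsogeny D Λ hΛ W κ hκ hW
  exact ⟨γ, hγ, 𝓓, ⟨V, ι, hι, hV, fun p hp => Set.mem_union_right _ (hpre p (hconf p hp))⟩, hlift⟩

/-- **(c4a-E) FROM THE LIFTED CARRIER** — `Raynaud1983_maninMumford → (N-U⁺) → ∀ C, PrintSheafHandleExistsEnd C` through p664145's
`printSheafHandleExistsEnd_of_stubs` with the LANDED S2 `MoverTrap.moverConfinement_of_KSimple` (p667380) and S3 `MoverTrap.kSimple_of_endTrivial` (p665569)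
BY NAME and THIS file's `properJumpCarrierEnd_of_lifted`. [cite: Raynaud1983SousVarietes, Théorème principal (p. 327)] [cite: Markman2025SecantWeil, §9.3 Lemma 9.3.11] -/
theorem printSheafHandleExistsEnd_of_lifted (hR : Raynaud1983_maninMumford) (h : UpstairsProperJumpLiftedCarrierEnd) :
    ∀ C : ChernCharacterBetti, PrintSheafHandleExistsEnd C :=
  printSheafHandleExistsEnd_of_stubs hR moverConfinement_of_KSimple kSimple_of_endTrivial (properJumpCarrierEnd_of_lifted h)

/-- (c4a-E) from (S4) alone, for the record (the same composition with (S4) displayed). [cite: Raynaud1983SousVarietes, Théorème principal (p. 327)] -/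
theorem printSheafHandleExistsEnd_of_properJumpCarrierEnd (hR : Raynaud1983_maninMumford) (h : ProperJumpCarrierEnd) :
    ∀ C : ChernCharacterBetti, PrintSheafHandleExistsEnd C :=
  printSheafHandleExistsEnd_of_stubs hR moverConfinement_of_KSimple kSimple_of_endTrivial h

/-! ## §3 The CRUX BY NAME, hypothesis form — `Lines/NowhereDisplaceable.lean` v2 §4 transcribed with (c4a-E) DISPLAYED (`hPSH`) instead of taken from stubs -/

section CruxByName

/-- The route's End-keyed anchor presentation predicate (v3.12 oHE), abbreviated (copy of the workfiles' `offHypDisjEndAnchors`). [cite: Markman2025SecantWeil, Thm. 1.4.1 («generic»)] -/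
abbrev offHypDisjEndAnchors : (Y : SchemeOver ℂ) → complexBetti Y 2 → Prop :=
  fun Y θ ↦ secantQuotientAnchorsPinned Y θ ∧ ∃ (D : SecantQuotientDatum) (e : Y ≅ D.Y.X) (θ₀ : complexBetti D.𝒥.J.X 2),
    ¬ D.𝒥.IsHyperelliptic ∧ OrbitTranslatesDisjoint D.𝒥 D.G₁ D.G₂ ∧ D.𝒥.J.IsPolarizationClassOf D.Θ θ₀ ∧
    (∀ f : D.𝒥.J ⟶ D.𝒥.J, ∃ n : ℤ, f = n • 𝟙 D.𝒥.J) ∧ complexBetti.map e.inv 2 θ = D.hY θ₀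

/-- The pinned-served classes plus the `θ³`-line, abbreviated (copy of the workfiles' `servedPlusTheta`). [cite: Markman2025SecantWeil, Thm. 1.4.1 (item 4)] -/
abbrev servedPlusTheta : (Y : SchemeOver ℂ) → complexBetti Y 2 → Set (complexBetti Y (2 * 3)) :=
  fun Y θ ↦ {w | ∃ γ, (γ = 0 ∨ γ ∈ secantQuotientServedClassesPinned Y θ) ∧ ∃ z : ℂ, w = γ + z • cupPowTwo θ 3}

/-- **ONE CARRIED CLASS from `hL` alone** (birth.lean `exists_carried_pinned_of_presentedOffHypDisj_of_pinnedForall`, transcribed; tree theorems only; third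
copy after `Lines/MoverTrap.lean` ∕ `Lines/NowhereDisplaceable.lean`). [cite: Markman2025SecantWeil, §1.5 (p. 7), Thm. 1.4.1 (item 4), §9.1 (p. 57) and §9.3 Lemma 9.3.11] -/
theorem exists_carried_pinned_of_presentedOffHypDisj_of_pinnedForall' {C : ChernCharacterBetti}
    (hLC : Markman2025_secantQuotient_twistedCarrier_onJacobian_pinnedForall C AdmTw')
    {X : SchemeOver ℂ} {θ : complexBetti X 2}
    (hpres : ∃ (D : SecantQuotientDatum) (e : X ≅ D.Y.X) (θ₀ : complexBetti D.𝒥.J.X 2),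
      ¬ D.𝒥.IsHyperelliptic ∧ OrbitTranslatesDisjoint D.𝒥 D.G₁ D.G₂ ∧ D.𝒥.J.IsPolarizationClassOf D.Θ θ₀ ∧ complexBetti.map e.inv 2 θ = D.hY θ₀) :
    ∃ w : complexBetti X (2 * 3), w ∈ secantQuotientServedClassesPinned X θ ∧ IsRationalClass w ∧
      w ∈ carriedClasses (twistedReflexiveClass C AdmTw') 6 3 X θ := by
  obtain ⟨D, e, θ₀, hnh, hH, hθ₀, hpin⟩ := hpres
  have hD : ∃ γ : complexBetti D.Y.X (2 * 3), IsTwistedCarrierWeilPairOn C AdmTw' D.𝒥.J D.isAmple D.KTheta_eq_bot D.G₁ D.G₂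
      D.succ_ne_zero D.G₁_le D.G₂_le D.d (D.hY θ₀) γ :=
    hLC D.d D.even D.four_le D.C D.smooth D.𝒥 D.dim_J D.Θ D.riemann D.principal D.G₁ D.G₂ D.G₁_le D.G₂_le hnh hH
      D.cyclic₁ D.card₁ D.cyclic₂ D.card₂ D.disjoint D.generalPosition θ₀ hθ₀
  obtain ⟨γ, hpol, hamp, hhyp, hγQ, hγray, hγW, hcopy⟩ := hD
  have hW : IsSecantQuotientWeilClassAtPinned D.Y.X (D.hY θ₀) γ :=
    IsSecantQuotientWeilClassAtPinned.of_refl D hθ₀ hpol hamp hhyp hγQ hγray hγW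
  have hθ : θ = complexBetti.map e.hom 2 (D.hY θ₀) := by rw [← hpin, e.complexBetti_map_hom_map_inv]
  obtain ⟨I, κ, c, h3, hκ, hκ3, hκk⟩ := hcopy X e
  refine ⟨complexBetti.map e.hom (2 * 3) γ, ?_, hγQ.map _, I, κ, 1, c, h3, hκ, one_ne_zero, ?_, fun k hk hk3 ↦ ?_⟩
  · rw [hθ]; exact hW.of_iso e
  · rw [one_smul, hθ]; exact hκ3
  · rw [hθ]; exact hκk k hk hk3

/-- **2s″ FROM A DISPLAYED (c4a-E)** — `AnchoredSpanAt` on the End-keyed anchor family from `hL`, the (c1) bound `hT`, the tree theorems (c2), (c3″), p664145's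
§3 composition and (c4-E), with `hPSH : ∀ C, PrintSheafHandleExistsEnd C` DISPLAYED (`Lines/NowhereDisplaceable.lean` v2 l.387ff with `hPSH C` for
`printSheafHandleExistsEnd_of hR C`). [cite: Markman2025SecantWeil, Thm. 1.4.1 (item 4)] -/
theorem anchoredSpan_63_offHypDisjEnd_of_pinnedForall_of_printSheafHandleExistsEnd
    (hPSH : ∀ C : ChernCharacterBetti, PrintSheafHandleExistsEnd C)
    (hL : ∀ C : ChernCharacterBetti, Markman2025_secantQuotient_twistedCarrier_onJacobian_pinnedForall C AdmTw')
    (hT : IsogenyPushforwardAdmissibilityTransferPrime) :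
    ∀ C : ChernCharacterBetti, AnchoredSpanAt (twistedReflexiveClass C AdmTw') 6 3 offHypDisjEndAnchors
      (fun Y θ ↦ secantQuotientServedClassesPinned Y θ) servedPlusTheta :=
  fun C ↦ anchoredSpanAt_served_of_two_carried_served fun Y θ hY ↦ by
    obtain ⟨hpin, hpres⟩ := hY
    have hpres' := hpres
    obtain ⟨D, e, θ₀, hnh, hH, hθ₀, _, hpinθ⟩ := hpres'
    obtain ⟨γ₁, hγ₁, -, hc₁⟩ := exists_carried_pinned_of_presentedOffHypDisj_of_pinnedForall' (hL C) ⟨D, e, θ₀, hnh, hH, hθ₀, hpinθ⟩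
    have h2m := secondCarried_63_offHypDisjEnd_of_hGoodEndNodesEnd C
      (fun D θ₀ hnh hH hθ₀ hEnd _ _ hg hm0 hm1 hm2 _ 𝓓 hγ₁ hC =>
        D.exists_secondCarried_of_pinnedForall_of_movedData_at (hL C)
          (isogenyMovesPinnedTwistedData_prime_of_transfer_of_chernCharacter hT (isogenyPushforwardChernCharacter_holds C))
          hnh hH hθ₀ (pinnedWeilPlaneRigidity_offHypDisj_of_endRingInt D θ₀ hnh hH hθ₀ hEnd) hg hm0 hm1 hm2 𝓓 hγ₁ hC)
      (offDiagonalExtVanishing_someMover_End_of_printSheafHandleExistsEnd C (hPSH C))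
    obtain ⟨γ₂, hγ₂, hc₂, hspan⟩ := h2m Y θ hpin hpres γ₁ hγ₁ hc₁
    exact ⟨γ₁, hγ₁, γ₂, hγ₂, hc₁, hc₂, hspan⟩

/-- **THE CRUX BY NAME FROM A DISPLAYED (c4a-E)** — hypothesis form: `hPSH` = (c4a-E), `h₁` = birth's 1′, `hT` = birth's (c1), `h₂ᵣ` = birth's 2r″, `h₃` = birth's 3′ᴸ,
plus the tree theorems (c2) ∕ (c3″). Reusable by every line closing (c4a-E). Nothing is thereby proved (HC ∕ HC_AV ∕ HC_CM ∕ №4 NOT proved).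
[cite: Markman2025SecantWeil, Thm. 1.4.1 (item 4)] -/
theorem DiagLocalOfMarkmanPinnedForall_of_printSheafHandleExistsEnd
    (hPSH : ∀ C : ChernCharacterBetti, PrintSheafHandleExistsEnd C)
    (h₁ : ∀ C : ChernCharacterBetti, LefAtExceptionalRegimeAt (twistedReflexiveClass C AdmTw') 4 2)
    (hT : IsogenyPushforwardAdmissibilityTransferPrime)
    (h₂ᵣ : ∀ C : ChernCharacterBetti,
      ∀ (X : SchemeOver ℂ), (∃ A' : AbelianVariety ℂ, A'.dim = 6 ∧ Nonempty (A'.X ≅ X)) →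
        ∀ w : complexBetti X (2 * 3), IsRationalClass w → IsOfHodgeType 6 X (2 * 3) 3 3 w →
          ¬ (w ∈ algebraicClasses X 3 ∧ w ∈ divisorClassesSpan X 6 3) →
          ¬ AnchorReachableAt 6 3 offHypDisjEndAnchors (fun Y θ ↦ secantQuotientServedClassesPinned Y θ) servedPlusTheta X w →
          LocallyServedAt (twistedReflexiveClass C AdmTw') 6 3 X w)
    (h₃ : ∀ (C : ChernCharacterBetti) (m : ℕ), 4 ≤ m → LefAtExceptionalRegimeAtLocal (twistedReflexiveClass C AdmTw') (2 * m) m) :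
    Summit.HodgeConjecture.HodgeConjecture.Theses.VHCAbelianSchemesRoad.DiagLocalOfMarkmanPinnedForall := by
  intro hL C m hm
  rcases Nat.lt_or_ge m 4 with hlt | hge
  · interval_cases m
    · exact lefAtExceptionalRegimeAtLocal_of_lefAtExceptionalRegimeAt (h₁ C)
    · exact lefAtExceptionalRegimeAtLocal_of_anchoredSpan_of_residual (twistedDoorPrime_respectsIso C)
        (anchoredSpan_63_offHypDisjEnd_of_pinnedForall_of_printSheafHandleExistsEnd hPSH hL hT C) (h₂ᵣ C)
  · exact h₃ C m hge

/-- **THE CRUX BY NAME THROUGH THE LIFTED CARRIER** — `Raynaud1983 → (N-U⁺) → ⟨1′⟩ → (c1) → ⟨2r″⟩ → ⟨3′ᴸ⟩ → <the route decl>`: the negation line's §4 with its three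
stubs (N-F), (N-I), (N-U) replaced by the ONE displayed residue (N-U⁺) ((N-I) being LANDED, (N-F) absorbed at the witness). Nothing is thereby proved
(HC ∕ HC_AV ∕ HC_CM ∕ №4 NOT proved). [cite: Markman2025SecantWeil, Thm. 1.4.1 (item 4)] [cite: Raynaud1983SousVarietes, Théorème principal (p. 327)] -/
theorem DiagLocalOfMarkmanPinnedForall_of_lifted (hR : Raynaud1983_maninMumford) (hU : UpstairsProperJumpLiftedCarrierEnd)
    (h₁ : ∀ C : ChernCharacterBetti, LefAtExceptionalRegimeAt (twistedReflexiveClass C AdmTw') 4 2)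
    (hT : IsogenyPushforwardAdmissibilityTransferPrime)
    (h₂ᵣ : ∀ C : ChernCharacterBetti,
      ∀ (X : SchemeOver ℂ), (∃ A' : AbelianVariety ℂ, A'.dim = 6 ∧ Nonempty (A'.X ≅ X)) →
        ∀ w : complexBetti X (2 * 3), IsRationalClass w → IsOfHodgeType 6 X (2 * 3) 3 3 w →
          ¬ (w ∈ algebraicClasses X 3 ∧ w ∈ divisorClassesSpan X 6 3) →
          ¬ AnchorReachableAt 6 3 offHypDisjEndAnchors (fun Y θ ↦ secantQuotientServedClassesPinned Y θ) servedPlusTheta X w →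
          LocallyServedAt (twistedReflexiveClass C AdmTw') 6 3 X w)
    (h₃ : ∀ (C : ChernCharacterBetti) (m : ℕ), 4 ≤ m → LefAtExceptionalRegimeAtLocal (twistedReflexiveClass C AdmTw') (2 * m) m) :
    Summit.HodgeConjecture.HodgeConjecture.Theses.VHCAbelianSchemesRoad.DiagLocalOfMarkmanPinnedForall :=
  DiagLocalOfMarkmanPinnedForall_of_printSheafHandleExistsEnd (printSheafHandleExistsEnd_of_lifted hR hU) h₁ hT h₂ᵣ h₃

end CruxByName

#print axioms upstairs_of_lifted
#print axioms lifted_of_upstairs_of_retract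
#print axioms properJumpCarrierEnd_of_lifted
#print axioms lifted_of_factorConfinedLifted
#print axioms jumpsLiftAt_of_retractAt
#print axioms lifted_of_retractCarrier
#print axioms printSheafHandleExistsEnd_of_lifted
#print axioms DiagLocalOfMarkmanPinnedForall_of_printSheafHandleExistsEnd
#print axioms DiagLocalOfMarkmanPinnedForall_of_lifted

end Summit.HodgeConjecture.HodgeConjecture.Cruxes.DiagLocalOfMarkmanPinnedForall.LiftedCarrier
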